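import Literature.NumberTheory.Automorphic.LocalUnitaryGroupSimilitude
import Literature.NumberTheory.Automorphic.LocalUnitaryIntegralLevel
import Mathlib.RingTheory.DedekindDomain.Different
import HarnessLib

/-!
# One family of local identifications `ψ_v : U(H)(L⁺_v) ≃ₜ* U(Φ₃)(L⁺_v)` that is CONJUGATION at every place and LEVEL-PRESERVING
# off a finite set (Rogawski (1990), §14.1–14.2 pp. 232–233; Platonov–Rapinchuk (1994), §2.3, §5.1)

Topic `NumberTheory/Automorphic`; namespace `Literature.NumberTheory.Automorphic.UnitaryGroup`. THEOREMS ONLY (no definition, no named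
fact, no instance, no notation). Sequel to ★ `LocalUnitaryGroupSimilitude` (a similitude `T_v` with `ᵗ(T̄_v) H_v T_v = a • (Φ₃)_v` at EVERY
finite `v`, so that `ψ_v = (g ↦ T_v⁻¹ g T_v)` satisfies `γ′ ↔ ψ_v γ′` for ★ `Rogawski1990.Corresponds`) and ★ `LocalUnitaryIntegralLevel` (the
levels `U(J)(𝒪_v)` and level matching at almost every place, there through isomorphisms whose shape is hidden behind an `∃`).

For the ENGINE T1 line (`F0_T1InnerFormTraceIdentity`, cell `hodgecm-mathlib`) ONE kit field `ψ` must serve three masters: the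
level-matching pin away from `S₀` ([Rogawski1990, §14.2 p. 233] «`K_v ≃ K′_v`, `f_v = f′_v`»), the anchored transfer (14.2.1) at `S₀`, and the
unramified inner transfer — the last two need `γ′ ↔ ψ_v(γ′)` (conjugacy in the common `GL₃(L ⊗ L⁺_v)`), which an abstract `Classical.choice`
of isomorphisms (★ `exists_psi_forall_levelMatching`) does not provide. This file re-runs the level matching with CONJUGATION isomorphisms:

* §1 `localFormCongr_mem_localIntegralLevel_iff` (+ `_symm`) — conjugation by a similitude `T` whose components `T_w ∈ GL_N(𝒪_w)` are
  integral matches the integral levels (`(T g T⁻¹)_w = T_w g_w T_w⁻¹`);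
* §2 `exists_glInt_formCongr_eq_of_split` — at a SPLIT place where `J_w, J'_w ∈ GL_N(𝒪_w)` for all `w ∣ v`, the similitude
  `T = (1, c⁻¹_*(J_w^{-ᵀ} J'_w^{ᵀ}))` of ★ `exists_formCongr_eq_of_split` is componentwise integral;
* §3 `coe_localNonsplitCongr_apply`, `corresponds_localNonsplitCongr[_symm]` — at a NON-SPLIT place the one-place transport ★
  `localNonsplitCongr … T` IS conjugation by the regrouped `T̃ ∈ GL_N(E_v)` (so it preserves `↔`); with the integral hyperbolic basis of
  ★ `exists_glInt_placeForm_eq_formCongr_antidiagonal_of_isUnramifiedIn` it matches the levels (`exists_conj_levelMatching_of_smul_eq`);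
* §4 CM, rank 3: **`exists_psi_conj_forall_levelMatching`** — for `H` anisotropic hermitian there are `ψ_v` (ALL finite `v`) and a finite `S₀`
  with `(ψ_v g) = S_v⁻¹ g S_v` for some `S_v ∈ GL₃(L ⊗ L⁺_v)` at EVERY `v` and `ψ_v(U(H)(𝒪_v)) = U(Φ₃)(𝒪_v)` for `v ∉ S₀`; hence
  `corresponds_of_coe_eq_conj` ∕ `…_symm`: `γ′ ↔ ψ_v γ′` and `ψ_v⁻¹ γ ↔ γ` everywhere.

## References
* J. Rogawski, Ann. of Math. Stud. 123 (1990), §14.1–14.2 pp. 232–233 (print) [Rogawski1990].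
* V. Platonov, A. Rapinchuk, *Algebraic Groups and Number Theory* (1994), §2.3, §5.1 [PlatonovRapinchuk1994].
* J. Tits, *Reductive groups over local fields*, PSPM 33.1 (1979), §3.8 [Tits1979].
-/

set_option autoImplicit false

noncomputable section

open NumberField IsDedekindDomain Filter
open Literature.AlgebraicGeometry.ShimuraVarieties (hermForm)
open Literature.NumberTheory.Rogawski1990 (Corresponds corresponds_comm)
open scoped Matrix MatrixGroups

namespace Literature.NumberTheory.Automorphic

namespace UnitaryGroup

section Generic

variable {F E : Type} [Field F] [NumberField F] [Field E] [NumberField E] [Algebra F E]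
  (c : E ≃ₐ[F] E) {N : ℕ}

/-! ## §1 Conjugation by a componentwise-integral similitude matches the integral levels -/

/-- **Integral similitudes match levels**: if every component `T_w ∈ GL_N(𝒪_w)` (`w ∣ v`) of the local similitude `T` is integral, then
`T g T⁻¹ ∈ U(J)(𝒪_v) ↔ g ∈ U(J')(𝒪_v)` along ★ `localFormCongr c v T ha h` (`(T g T⁻¹)_w = T_w g_w T_w⁻¹` and `GL_N(𝒪_w)` is a group).
[cite: PlatonovRapinchuk1994, §5.1] -/
theorem localFormCongr_mem_localIntegralLevel_iff (v : HeightOneSpectrum (𝓞 F)) (T : GL (Fin N) (LocalRing E v))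
    {a : LocalRing E v} (ha : IsUnit a) {J J' : Matrix (Fin N) (Fin N) E}
    (h : formCongr (conjLocal E c v) T (J.map (algebraMap E (LocalRing E v))) = a • J'.map (algebraMap E (LocalRing E v)))
    (hT : ∀ w : PlacesOver E v, localGLPiEquiv E N v T w ∈ glInt N (w.1.adicCompletion E)) (g : «local» E c N J' v) :
    localFormCongr c v T ha h g ∈ localIntegralLevel c N J v ↔ g ∈ localIntegralLevel c N J' v := by
  rw [mem_localIntegralLevel_iff, mem_localIntegralLevel_iff]
  refine forall_congr' fun w => ?_
  rw [coe_localFormCongr_apply, map_mul, map_mul, map_inv, Pi.mul_apply, Pi.mul_apply, Pi.inv_apply,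
    Subgroup.mul_mem_cancel_right _ (Subgroup.inv_mem _ (hT w)), Subgroup.mul_mem_cancel_left _ (hT w)]

/-- The inverse direction: `T⁻¹ g T ∈ U(J')(𝒪_v) ↔ g ∈ U(J)(𝒪_v)` for componentwise-integral `T`. [cite: PlatonovRapinchuk1994, §5.1] -/
theorem localFormCongr_symm_mem_localIntegralLevel_iff (v : HeightOneSpectrum (𝓞 F)) (T : GL (Fin N) (LocalRing E v))
    {a : LocalRing E v} (ha : IsUnit a) {J J' : Matrix (Fin N) (Fin N) E}
    (h : formCongr (conjLocal E c v) T (J.map (algebraMap E (LocalRing E v))) = a • J'.map (algebraMap E (LocalRing E v)))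
    (hT : ∀ w : PlacesOver E v, localGLPiEquiv E N v T w ∈ glInt N (w.1.adicCompletion E)) (g : «local» E c N J v) :
    (localFormCongr c v T ha h).symm g ∈ localIntegralLevel c N J' v ↔ g ∈ localIntegralLevel c N J v := by
  rw [← localFormCongr_mem_localIntegralLevel_iff c v T ha h hT ((localFormCongr c v T ha h).symm g),
    ContinuousMulEquiv.apply_symm_apply]

/-- **Conjugation formulas give `↔`**: if an isomorphism `e : U(J')(F_v) ≃ₜ* U(J)(F_v)` is `g ↦ S⁻¹ g S` on matrices for some
`S ∈ GL_N(E_v)`, then `γ′ ↔ e γ′` for every `γ′`. [cite: Rogawski1990, §14.1 p. 232] -/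
theorem corresponds_of_coe_eq_conj (v : HeightOneSpectrum (𝓞 F)) {J J' : Matrix (Fin N) (Fin N) E}
    (e : «local» E c N J' v ≃ₜ* «local» E c N J v) (S : GL (Fin N) (LocalRing E v))
    (he : ∀ g : «local» E c N J' v, ((e g : «local» E c N J v) : GL (Fin N) (LocalRing E v)) = S⁻¹ * g * S) (γ' : «local» E c N J' v) :
    Corresponds (conjLocal E c v) ((adelicForm E N J').map (adeleToLocal E v)) ((adelicForm E N J).map (adeleToLocal E v)) γ' (e γ') :=
  isConj_iff.2 ⟨S⁻¹, by rw [he, inv_inv]⟩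

/-- … and `e⁻¹ γ ↔ γ` for every `γ` (`e⁻¹ γ = S γ S⁻¹`). [cite: Rogawski1990, §14.1 p. 232] -/
theorem corresponds_symm_of_coe_eq_conj (v : HeightOneSpectrum (𝓞 F)) {J J' : Matrix (Fin N) (Fin N) E}
    (e : «local» E c N J' v ≃ₜ* «local» E c N J v) (S : GL (Fin N) (LocalRing E v))
    (he : ∀ g : «local» E c N J' v, ((e g : «local» E c N J v) : GL (Fin N) (LocalRing E v)) = S⁻¹ * g * S) (γ : «local» E c N J v) :
    Corresponds (conjLocal E c v) ((adelicForm E N J').map (adeleToLocal E v)) ((adelicForm E N J).map (adeleToLocal E v)) (e.symm γ) γ := by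
  refine isConj_iff.2 ⟨S⁻¹, ?_⟩
  have h1 := he (e.symm γ)
  rw [ContinuousMulEquiv.apply_symm_apply] at h1
  rw [inv_inv]
  exact h1.symm

/-! ## §2 Split places: the similitude `(1, c⁻¹_*(J_w^{-ᵀ} J'_w^{ᵀ}))` is integral where `J`, `J'` are -/

section Split

variable [Algebra.IsQuadraticExtension F E] {J J' : Matrix (Fin N) (Fin N) E} {v : HeightOneSpectrum (𝓞 F)}

open scoped Classical in
/-- **Integral similitude at a good split place**: for `w ∣ v` with `c • w ≠ w`, `J, J'` `c`-hermitian invertible with `J_{w'}, J'_{w'} ∈ GL_N(𝒪_{w'})`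
for all `w' ∣ v`, there is a COMPONENTWISE-INTEGRAL `T ∈ GL_N(E_v)` with `ᵗ((c ⊗ 1) T) · J_v · T = J'_v` — the `T = (1, c⁻¹_*(J_w^{-ᵀ} J'_w^{ᵀ}))`
of ★ `exists_formCongr_eq_of_split` (`GL_N(𝒪)` is stable under contragredient and Galois transport: ★ `contragredient_mem_glInt`,
★ `map_galAdicCompletionMap_mem_glInt_iff`). [cite: PlatonovRapinchuk1994, §5.1] [cite: Tits1979, §3.8] -/
theorem exists_glInt_formCongr_eq_of_split (hc : c ≠ 1) (hJ : (J.map c)ᵀ = J) (hJ' : (J'.map c)ᵀ = J') (hJu : IsUnit J)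
    (hJ'u : IsUnit J') (w : PlacesOver E v) (hw : c • w.1 ≠ w.1)
    (hint : ∀ w' : PlacesOver E v, (isUnit_placeForm J hJu w'.1).unit ∈ glInt N (w'.1.adicCompletion E))
    (hint' : ∀ w' : PlacesOver E v, (isUnit_placeForm J' hJ'u w'.1).unit ∈ glInt N (w'.1.adicCompletion E)) :
    ∃ T : GL (Fin N) (LocalRing E v), (∀ w' : PlacesOver E v, localGLPiEquiv E N v T w' ∈ glInt N (w'.1.adicCompletion E)) ∧
      formCongr (conjLocal E c v) T (J.map (algebraMap E (LocalRing E v))) = J'.map (algebraMap E (LocalRing E v)) := by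
  -- the two forms at `w`, as (integral) units, and the `c⁻¹ w`-component `X = J_w^{-ᵀ} J'_w^{ᵀ}`
  set Jw : GL (Fin N) (w.1.adicCompletion E) := (isUnit_placeForm J hJu w.1).unit with hJw_def
  set J'w : GL (Fin N) (w.1.adicCompletion E) := (isUnit_placeForm J' hJ'u w.1).unit with hJ'w_def
  have hJw : (Jw : Matrix (Fin N) (Fin N) (w.1.adicCompletion E)) = placeForm J w.1 := (isUnit_placeForm J hJu w.1).unit_spec
  have hJ'w : (J'w : Matrix (Fin N) (Fin N) (w.1.adicCompletion E)) = placeForm J' w.1 := (isUnit_placeForm J' hJ'u w.1).unit_spec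
  set X : GL (Fin N) (w.1.adicCompletion E) := GLn.contragredient Jw * (GLn.contragredient J'w)⁻¹ with hX_def
  have hXint : X ∈ glInt N (w.1.adicCompletion E) :=
    Subgroup.mul_mem _ (contragredient_mem_glInt w.1 (hint w)) (Subgroup.inv_mem _ (contragredient_mem_glInt w.1 (hint' w)))
  have hX : ((X : GL (Fin N) (w.1.adicCompletion E)) : Matrix (Fin N) (Fin N) (w.1.adicCompletion E))ᵀ * placeForm J w.1 =
      placeForm J' w.1 := by
    rw [hX_def, Units.val_mul, Matrix.transpose_mul, GLn.coe_contragredient_inv, GLn.coe_contragredient_transpose,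
      Matrix.transpose_transpose, ← hJw, Matrix.mul_assoc, ← Units.val_mul, inv_mul_cancel, Units.val_one, Matrix.mul_one, hJ'w]
  -- the family `u = (1 at w, c⁻¹_* X at c⁻¹ w)` and `T`
  let u : LocalGLPi E N v := fun w' =>
    Matrix.GeneralLinearGroup.map (galAdicCompletionMap (splitGal c w w') (splitGal_smul c hc w w')) (if w'.1 = w.1 then 1 else X)
  have huint : ∀ w' : PlacesOver E v, u w' ∈ glInt N (w'.1.adicCompletion E) := by
    intro w'
    refine (map_galAdicCompletionMap_mem_glInt_iff _ _ _).2 ?_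
    split_ifs
    · exact Subgroup.one_mem _
    · exact hXint
  have huw : u w = 1 := by
    change Matrix.GeneralLinearGroup.map _ (if w.1 = w.1 then 1 else X) = 1
    rw [if_pos rfl, map_one]
  have hne : (PlacesOver.galInv c w).1 ≠ w.1 := fun h => PlacesOver.galInv_ne c w hw (Subtype.ext h)
  have hug : ((u (PlacesOver.galInv c w) : GL (Fin N) ((PlacesOver.galInv c w).1.adicCompletion E)) :
        Matrix (Fin N) (Fin N) ((PlacesOver.galInv c w).1.adicCompletion E)).map (galAdicCompletionMap c (smul_inv_smul c w.1)) =
      ((X : GL (Fin N) (w.1.adicCompletion E)) : Matrix (Fin N) (Fin N) (w.1.adicCompletion E)) := by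
    have hu' : u (PlacesOver.galInv c w) =
        Matrix.GeneralLinearGroup.map (galAdicCompletionMap c⁻¹ (rfl : c⁻¹ • w.1 = (PlacesOver.galInv c w).1)) X := by
      change Matrix.GeneralLinearGroup.map _ (if (PlacesOver.galInv c w).1 = w.1 then 1 else X) = _
      rw [if_neg hne, map_galAdicCompletionMap_congr_left (splitGal_of_ne c hne)]
    rw [hu']
    exact congrArg (fun g : GL (Fin N) (w.1.adicCompletion E) => (g : Matrix (Fin N) (Fin N) (w.1.adicCompletion E)))
      (map_galAdicCompletionMap_apply_inv c (smul_inv_smul c w.1) rfl X)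
  have hw_eq : (((u (PlacesOver.galInv c w) : GL (Fin N) ((PlacesOver.galInv c w).1.adicCompletion E)) :
          Matrix (Fin N) (Fin N) ((PlacesOver.galInv c w).1.adicCompletion E)).map
        (galAdicCompletionMap c (smul_inv_smul c w.1)))ᵀ * placeForm J w.1 *
      ((u w : GL (Fin N) (w.1.adicCompletion E)) : Matrix (Fin N) (Fin N) (w.1.adicCompletion E)) = placeForm J' w.1 := by
    rw [hug, huw, Units.val_one, Matrix.mul_one, hX]
  refine ⟨(localGLPiEquiv E N v).symm u, fun w' => ?_, ?_⟩
  · rw [ContinuousMulEquiv.apply_symm_apply]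
    exact huint w'
  rw [← adelicForm_map_adeleToLocal, ← adelicForm_map_adeleToLocal, Matrix.eq_iff_forall_map_evalRingHom]
  intro w''
  rw [formCongr_localGLPiEquiv_symm_map_eval, localForm_map_eval]
  rcases PlacesOver.eq_or_eq_galInv c hc w w'' with rfl | rfl
  · exact hw_eq
  · exact formCongr_eval_galInv_of_eval c hc hJ hJ' w u hw_eq

end Split

/-! ## §3 Non-split places: the one-place transport `localNonsplitCongr` is conjugation in `GL_N(E_v)` -/

section Nonsplit

variable [Algebra.IsQuadraticExtension F E] {J J' : Matrix (Fin N) (Fin N) E} {v : HeightOneSpectrum (𝓞 F)}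

/-- **The one-place transport is conjugation**: at a non-split place (`c • w = w`), for `T ∈ GL_N(E_w)` with `ᵗ(σ_w T) · J_w · T = a • J'_w`,
★ `localNonsplitCongr … T : U(J')(F_v) ≃ₜ* U(J)(F_v)` is `g ↦ T̃ g T̃⁻¹` on matrices, `T̃ ∈ GL_N(E_v)` the regrouping of `T` (`E_v = E_w`, `w` the
only place above `v`). [cite: PlatonovRapinchuk1994, §2.3] -/
theorem coe_localNonsplitCongr_apply (hc : c ≠ 1) (w : PlacesOver E v) (hw : c • w.1 = w.1) (T : GL (Fin N) (w.1.adicCompletion E))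
    {a : w.1.adicCompletion E} (ha : IsUnit a)
    (h : formCongr (galAdicCompletionMap (L := E) c hw) T (placeForm J w.1) = a • placeForm J' w.1) (g : «local» E c N J' v) :
    ((localNonsplitCongr c hc w hw T ha h g : «local» E c N J v) : GL (Fin N) (LocalRing E v)) =
      (localGLPiEquiv E N v).symm ((localGLPiEvalEquiv c N hc w hw).symm T) * (g : GL (Fin N) (LocalRing E v)) *
        ((localGLPiEquiv E N v).symm ((localGLPiEvalEquiv c N hc w hw).symm T))⁻¹ := by
  haveI : Subsingleton (PlacesOver E v) := PlacesOver.subsingleton_of_smul_eq c hc w hw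
  apply (localGLPiEquiv E N v).injective
  funext w'
  obtain rfl : w = w' := Subsingleton.elim w w'
  have hcoe : ∀ (J₀ : Matrix (Fin N) (Fin N) E) (g₀ : «local» E c N J₀ v),
      ((localNonsplitEquiv c J₀ hc w hw g₀ : unitaryGroupOfForm (galAdicCompletionMap (L := E) c hw) (placeForm J₀ w.1)) :
        GL (Fin N) (w.1.adicCompletion E)) = localGLPiEquiv E N v (g₀ : GL (Fin N) (LocalRing E v)) w := fun _ _ => rfl
  rw [← hcoe J, localNonsplitEquiv_localNonsplitCongr, hcoe J', map_mul, map_mul, map_inv, Pi.mul_apply, Pi.mul_apply, Pi.inv_apply,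
    ContinuousMulEquiv.apply_symm_apply, localGLPiEvalEquiv_symm_apply_self]

/-- Hence `γ′ ↔ localNonsplitCongr … γ′` for every `γ′`. [cite: Rogawski1990, §14.1 p. 232] -/
theorem corresponds_localNonsplitCongr (hc : c ≠ 1) (w : PlacesOver E v) (hw : c • w.1 = w.1) (T : GL (Fin N) (w.1.adicCompletion E))
    {a : w.1.adicCompletion E} (ha : IsUnit a)
    (h : formCongr (galAdicCompletionMap (L := E) c hw) T (placeForm J w.1) = a • placeForm J' w.1) (γ' : «local» E c N J' v) :
    Corresponds (conjLocal E c v) ((adelicForm E N J').map (adeleToLocal E v)) ((adelicForm E N J).map (adeleToLocal E v))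
      γ' (localNonsplitCongr c hc w hw T ha h γ') :=
  corresponds_of_coe_eq_conj c v _ ((localGLPiEquiv E N v).symm ((localGLPiEvalEquiv c N hc w hw).symm T))⁻¹
    (fun g => by rw [coe_localNonsplitCongr_apply, inv_inv]) γ'

/-- **Conjugation + level matching at a good non-split place**: `v` unramified in `E`, `c • w = w`, `J` `c`-hermitian with `J_w ∈ GL_N(𝒪_w)`:
the integral hyperbolic basis (★ `exists_glInt_placeForm_eq_formCongr_antidiagonal_of_isUnramifiedIn`) gives `ψ : U(J)(F_v) ≃ₜ* U(Φ_N)(F_v)` with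
`ψ g = S⁻¹ g S` on matrices and `ψ g ∈ U(Φ_N)(𝒪_v) ↔ g ∈ U(J)(𝒪_v)` (re-run of ★ `exists_continuousMulEquiv_localIntegralLevel_iff_of_smul_eq`
exposing the conjugation). [cite: Rogawski1990, §14.2 p. 233] -/
theorem exists_conj_levelMatching_of_smul_eq (hc : c ≠ 1) (hJh : (J.map c)ᵀ = J) (w : PlacesOver E v) (hw : c • w.1 = w.1)
    (hv : Algebra.IsUnramifiedIn (𝓞 E) v.asIdeal) (hJw : IsUnit (placeForm J w.1)) (hJi : hJw.unit ∈ glInt N (w.1.adicCompletion E)) :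
    ∃ ψ : «local» E c N J v ≃ₜ* «local» E c N (Matrix.of fun i j : Fin N => if i.val + j.val + 1 = N then (1 : E) else 0) v,
      (∃ S : GL (Fin N) (LocalRing E v), ∀ g, ((ψ g : «local» E c N _ v) : GL (Fin N) (LocalRing E v)) = S⁻¹ * g * S) ∧
      ∀ g, ψ g ∈ localIntegralLevel c N (Matrix.of fun i j : Fin N => if i.val + j.val + 1 = N then (1 : E) else 0) v ↔
        g ∈ localIntegralLevel c N J v := by
  obtain ⟨T, hT, hJT⟩ := exists_glInt_placeForm_eq_formCongr_antidiagonal_of_isUnramifiedIn F E c hc N J hJh v w hw hv hJw hJi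
  have h : formCongr (galAdicCompletionMap (L := E) c hw) T
      (placeForm (Matrix.of fun i j : Fin N => if i.val + j.val + 1 = N then (1 : E) else 0) w.1) = (1 : w.1.adicCompletion E) • placeForm J w.1 := by
    rw [one_smul, placeForm_antidiagOne, ← hJT]
  refine ⟨localNonsplitCongr c hc w hw T isUnit_one h,
    ⟨((localGLPiEquiv E N v).symm ((localGLPiEvalEquiv c N hc w hw).symm T))⁻¹, fun g => by rw [coe_localNonsplitCongr_apply, inv_inv]⟩,
    fun g => ?_⟩
  rw [mem_localIntegralLevel_iff_of_smul_eq c N _ hc w hw, mem_localIntegralLevel_iff_of_smul_eq c N J hc w hw,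
    localNonsplitEquiv_localNonsplitCongr]
  constructor
  · intro h'
    have h'' := Subgroup.mul_mem _ (Subgroup.mul_mem _ (Subgroup.inv_mem _ hT) h') hT
    simpa only [mul_assoc, mul_inv_cancel_left, inv_mul_cancel, mul_one, inv_mul_cancel_left] using h''
  · intro h'
    exact Subgroup.mul_mem _ (Subgroup.mul_mem _ hT h') (Subgroup.inv_mem _ hT)

/-- **Conjugation + level matching at a good split place** (`c • w ≠ w`, `J_{w'} ∈ GL_N(𝒪_{w'})` for all `w' ∣ v`): `ψ = (g ↦ T⁻¹ g T)` for the integral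
similitude of §2 onto `Φ_N` (`Φ_N` is hyperspecial everywhere, ★ `unit_placeForm_antidiagOne_mem_glInt`). [cite: Rogawski1990, §14.2 p. 233] -/
theorem exists_conj_levelMatching_of_ne (hc : c ≠ 1) (hJh : (J.map c)ᵀ = J) (hJu : IsUnit J) (w : PlacesOver E v) (hw : c • w.1 ≠ w.1)
    (hint : ∀ w' : PlacesOver E v, (isUnit_placeForm J hJu w'.1).unit ∈ glInt N (w'.1.adicCompletion E)) :
    ∃ ψ : «local» E c N J v ≃ₜ* «local» E c N (Matrix.of fun i j : Fin N => if i.val + j.val + 1 = N then (1 : E) else 0) v,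
      (∃ S : GL (Fin N) (LocalRing E v), ∀ g, ((ψ g : «local» E c N _ v) : GL (Fin N) (LocalRing E v)) = S⁻¹ * g * S) ∧
      ∀ g, ψ g ∈ localIntegralLevel c N (Matrix.of fun i j : Fin N => if i.val + j.val + 1 = N then (1 : E) else 0) v ↔
        g ∈ localIntegralLevel c N J v := by
  have hΦu : IsUnit (Matrix.of fun i j : Fin N => if i.val + j.val + 1 = N then (1 : E) else 0) := by
    rw [antidiagOne_eq_over]; exact StdForm.isUnit_over _ E
  have hintΦ : ∀ w' : PlacesOver E v, (isUnit_placeForm _ hΦu w'.1).unit ∈ glInt N (w'.1.adicCompletion E) := by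
    intro w'
    have he : (isUnit_placeForm _ hΦu w'.1).unit = (isUnit_placeForm_antidiagOne (E := E) N w'.1).unit :=
      Units.ext ((IsUnit.unit_spec _).trans (IsUnit.unit_spec _).symm)
    rw [he]; exact unit_placeForm_antidiagOne_mem_glInt N w'.1
  obtain ⟨T, hTint, hT⟩ := exists_glInt_formCongr_eq_of_split c hc hJh (antidiagOne_map_transpose c N) hJu hΦu w hw hint hintΦ
  have h1 : formCongr (conjLocal E c v) T (J.map (algebraMap E (LocalRing E v))) =
      (1 : LocalRing E v) • (Matrix.of fun i j : Fin N => if i.val + j.val + 1 = N then (1 : E) else 0).map (algebraMap E (LocalRing E v)) := by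
    rw [hT, one_smul]
  exact ⟨(localFormCongr c v T isUnit_one h1).symm, ⟨T, fun g => rfl⟩,
    fun g => localFormCongr_symm_mem_localIntegralLevel_iff c v T isUnit_one h1 hTint g⟩

end Nonsplit

/-- Only finitely many places of `F` ramify in `E` (prime factors of the different; private copy of the tree's
`Literature.NumberTheory.GaloisRepresentations.finite_setOf_not_isUnramifiedIn`, kept local to avoid the `L`-function imports). [folklore] -/
private theorem finite_setOf_not_isUnramifiedIn_local :
    {v : HeightOneSpectrum (𝓞 F) | ¬ Algebra.IsUnramifiedIn (𝓞 E) v.asIdeal}.Finite := by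
  have hD : differentIdeal (𝓞 F) (𝓞 E) ≠ ⊥ := differentIdeal_ne_bot
  have hfin : {Q : HeightOneSpectrum (𝓞 E) | Q.asIdeal ∣ differentIdeal (𝓞 F) (𝓞 E)}.Finite := Ideal.finite_factors hD
  refine (hfin.image fun Q => Q.under (𝓞 F)).subset ?_
  intro q hq
  simp only [Set.mem_setOf_eq, Algebra.IsUnramifiedIn, not_forall] at hq
  obtain ⟨Q, hQprime, hQover, hQunr⟩ := hq
  haveI := hQprime
  have hQne : Q ≠ ⊥ := Ideal.ne_bot_of_liesOver_of_ne_bot q.ne_bot Q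
  refine ⟨⟨Q, hQprime, hQne⟩, ?_, ?_⟩
  · exact dvd_differentIdeal_iff.mpr hQunr
  · exact HeightOneSpectrum.ext hQover.over.symm

/-- **Conjugation + level matching at almost every place** (`c ≠ 1`, `J` `c`-hermitian with `det J` a unit): `∀ᶠ v`, there is
`ψ_v : U(J)(F_v) ≃ₜ* U(Φ_N)(F_v)` that is conjugation by some `S_v ∈ GL_N(E_v)` on matrices AND matches the integral levels (§3 at non-split
unramified `v` with `J_w` integral, `exists_conj_levelMatching_of_ne` at split ones). [cite: Rogawski1990, §14.2 p. 233] -/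
theorem eventually_exists_conj_levelMatching [Algebra.IsQuadraticExtension F E] {J : Matrix (Fin N) (Fin N) E} (hc : c ≠ 1)
    (hJh : (J.map c)ᵀ = J) (hJ : IsUnit J.det) :
    ∀ᶠ v : HeightOneSpectrum (𝓞 F) in cofinite,
      ∃ ψ : «local» E c N J v ≃ₜ* «local» E c N (Matrix.of fun i j : Fin N => if i.val + j.val + 1 = N then (1 : E) else 0) v,
        (∃ S : GL (Fin N) (LocalRing E v), ∀ g, ((ψ g : «local» E c N _ v) : GL (Fin N) (LocalRing E v)) = S⁻¹ * g * S) ∧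
        ∀ g, ψ g ∈ localIntegralLevel c N (Matrix.of fun i j : Fin N => if i.val + j.val + 1 = N then (1 : E) else 0) v ↔
          g ∈ localIntegralLevel c N J v := by
  have hJu : IsUnit J := (Matrix.isUnit_iff_isUnit_det J).2 hJ
  filter_upwards [eventually_forall_unit_placeForm_mem_glInt (F := F) N J hJu,
    (finite_setOf_not_isUnramifiedIn_local (F := F) (E := E)).compl_mem_cofinite] with v hint hunr
  have hv : Algebra.IsUnramifiedIn (𝓞 E) v.asIdeal := not_not.1 hunr
  obtain ⟨w⟩ := (inferInstance : Nonempty (PlacesOver E v))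
  by_cases hw : c • w.1 = w.1
  · exact exists_conj_levelMatching_of_smul_eq c hc hJh w hw hv (isUnit_placeForm J hJu w.1) (hint w)
  · exact exists_conj_levelMatching_of_ne c hc hJh hJu w hw hint

end Generic

/-! ## §4 The CM case in rank `3`: ONE `ψ` — conjugation everywhere, level-preserving off `S₀` -/

section CM

variable (L : Type) [Field L] [NumberField L] [IsCMField L]

/-- **(Ψ⁺) For an ANISOTROPIC hermitian `H ∈ M₃(L)`: local identifications `ψ_v : U(H)(L⁺_v) ≃ₜ* U(Φ₃)(L⁺_v)` at EVERY finite place that are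
CONJUGATIONS `g ↦ S_v⁻¹ g S_v` (`S_v ∈ GL₃(L ⊗ L⁺_v)`) and, off a finite `S₀`, match the integral levels** `ψ_v(U(H)(𝒪_v)) = U(Φ₃)(𝒪_v)` —
[Rogawski1990, §14.1–14.2 pp. 232–233]: «we fix an inner isomorphism `ψ : G′ → G`» together with «for `v ∉ S₀ ∪ S`, `K_v ≃ K′_v`». Away from the
finite exceptional set: `eventually_exists_conj_levelMatching`; at the remaining places: the similitude of ★ `exists_cmDatum_localEquiv_corresponds`.
Strengthens ★ `exists_psi_forall_levelMatching` (whose `ψ_v` were chosen abstractly). [cite: Rogawski1990, §14.2 p. 233] -/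
theorem exists_psi_conj_forall_levelMatching (H : Matrix (Fin 3) (Fin 3) L)
    (hanis : ∀ x : Fin 3 → L, hermForm (cmConjRingHom L) H x x = 0 → x = 0) (hherm : (H.map (cmConjRingHom L))ᵀ = H) :
    ∃ (ψ : ∀ v : HeightOneSpectrum (𝓞 ↥(maximalRealSubfield L)), (cmDatum L 3 H).Local v ≃ₜ*
        (cmDatum L 3 (Matrix.of fun i j : Fin 3 => if i.val + j.val + 1 = 3 then (1 : L) else 0)).Local v)
      (S₀ : Finset (HeightOneSpectrum (𝓞 ↥(maximalRealSubfield L)))),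
      (∀ v, ∃ S : GL (Fin 3) (LocalRing L v), ∀ g : (cmDatum L 3 H).Local v, ((ψ v g).val : GL (Fin 3) (LocalRing L v)) = S⁻¹ * g.val * S) ∧
      ∀ v ∉ S₀, ∀ g, ψ v g ∈ cmLocalIntegralLevel L 3 (Matrix.of fun i j : Fin 3 => if i.val + j.val + 1 = 3 then (1 : L) else 0) v ↔
        g ∈ cmLocalIntegralLevel L 3 H v := by
  classical
  have hHd : IsUnit H.det := isUnit_iff_ne_zero.2 (Godement.det_ne_zero_of_anisotropic L H hanis)
  have hev := eventually_exists_conj_levelMatching (IsCMField.complexConj L) (N := 3) (J := H) (IsCMField.complexConj_ne_one L)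
    ((map_cmConjRingHom_eq_map_complexConj L H) ▸ hherm) hHd
  rw [Filter.eventually_cofinite] at hev
  -- the everywhere-fallback: conjugation by the similitude of `exists_cmDatum_localEquiv_corresponds`
  have hall : ∀ v : HeightOneSpectrum (𝓞 ↥(maximalRealSubfield L)), ∃ e : (cmDatum L 3 H).Local v ≃ₜ*
      (cmDatum L 3 (Matrix.of fun i j : Fin 3 => if i.val + j.val + 1 = 3 then (1 : L) else 0)).Local v,
      ∃ S : GL (Fin 3) (LocalRing L v), ∀ g : (cmDatum L 3 H).Local v, ((e g).val : GL (Fin 3) (LocalRing L v)) = S⁻¹ * g.val * S := by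
    intro v
    obtain ⟨T, e, he, -, -⟩ := exists_cmDatum_localEquiv_corresponds L H hanis hherm v
    exact ⟨e, T, he⟩
  refine ⟨fun v => if h : ∃ ψ : (cmDatum L 3 H).Local v ≃ₜ*
        (cmDatum L 3 (Matrix.of fun i j : Fin 3 => if i.val + j.val + 1 = 3 then (1 : L) else 0)).Local v,
        (∃ S : GL (Fin 3) (LocalRing L v), ∀ g : (cmDatum L 3 H).Local v, ((ψ g).val : GL (Fin 3) (LocalRing L v)) = S⁻¹ * g.val * S) ∧
          ∀ g, ψ g ∈ cmLocalIntegralLevel L 3 (Matrix.of fun i j : Fin 3 => if i.val + j.val + 1 = 3 then (1 : L) else 0) v ↔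
            g ∈ cmLocalIntegralLevel L 3 H v
      then h.choose else (hall v).choose, hev.toFinset, fun v => ?_, fun v hv g => ?_⟩
  · by_cases h : ∃ ψ : (cmDatum L 3 H).Local v ≃ₜ*
        (cmDatum L 3 (Matrix.of fun i j : Fin 3 => if i.val + j.val + 1 = 3 then (1 : L) else 0)).Local v,
        (∃ S : GL (Fin 3) (LocalRing L v), ∀ g : (cmDatum L 3 H).Local v, ((ψ g).val : GL (Fin 3) (LocalRing L v)) = S⁻¹ * g.val * S) ∧
          ∀ g, ψ g ∈ cmLocalIntegralLevel L 3 (Matrix.of fun i j : Fin 3 => if i.val + j.val + 1 = 3 then (1 : L) else 0) v ↔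
            g ∈ cmLocalIntegralLevel L 3 H v
    · simp only [dif_pos h]
      exact h.choose_spec.1
    · simp only [dif_neg h]
      exact (hall v).choose_spec
  · have h : ∃ ψ : (cmDatum L 3 H).Local v ≃ₜ*
        (cmDatum L 3 (Matrix.of fun i j : Fin 3 => if i.val + j.val + 1 = 3 then (1 : L) else 0)).Local v,
        (∃ S : GL (Fin 3) (LocalRing L v), ∀ g : (cmDatum L 3 H).Local v, ((ψ g).val : GL (Fin 3) (LocalRing L v)) = S⁻¹ * g.val * S) ∧
          ∀ g, ψ g ∈ cmLocalIntegralLevel L 3 (Matrix.of fun i j : Fin 3 => if i.val + j.val + 1 = 3 then (1 : L) else 0) v ↔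
            g ∈ cmLocalIntegralLevel L 3 H v := by
      rw [Set.Finite.mem_toFinset] at hv
      exact not_not.1 hv
    simp only [dif_pos h]
    exact h.choose_spec.2 g

/-- **`γ′ ↔ ψ_v γ′` and `ψ_v⁻¹ γ ↔ γ` at EVERY finite place** for the family (Ψ⁺) — the class-preservation hypothesis of the unramified and
the anchored local transfer (14.2.1), in the tokens of ★ `IsLocalInnerTransfer`. [cite: Rogawski1990, §14.2 (14.2.1) p. 232] -/
theorem exists_psi_corresponds_forall_levelMatching (H : Matrix (Fin 3) (Fin 3) L)
    (hanis : ∀ x : Fin 3 → L, hermForm (cmConjRingHom L) H x x = 0 → x = 0) (hherm : (H.map (cmConjRingHom L))ᵀ = H) :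
    ∃ (ψ : ∀ v : HeightOneSpectrum (𝓞 ↥(maximalRealSubfield L)), (cmDatum L 3 H).Local v ≃ₜ*
        (cmDatum L 3 (Matrix.of fun i j : Fin 3 => if i.val + j.val + 1 = 3 then (1 : L) else 0)).Local v)
      (S₀ : Finset (HeightOneSpectrum (𝓞 ↥(maximalRealSubfield L)))),
      (∀ v (γ' : (cmDatum L 3 H).Local v),
        Corresponds (conjLocal L (IsCMField.complexConj L) v) ((adelicForm L 3 H).map (adeleToLocal L v))
          ((adelicForm L 3 (Matrix.of fun i j : Fin 3 => if i.val + j.val + 1 = 3 then (1 : L) else 0)).map (adeleToLocal L v))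
          γ' (ψ v γ')) ∧
      (∀ v (γ : (cmDatum L 3 (Matrix.of fun i j : Fin 3 => if i.val + j.val + 1 = 3 then (1 : L) else 0)).Local v),
        Corresponds (conjLocal L (IsCMField.complexConj L) v) ((adelicForm L 3 H).map (adeleToLocal L v))
          ((adelicForm L 3 (Matrix.of fun i j : Fin 3 => if i.val + j.val + 1 = 3 then (1 : L) else 0)).map (adeleToLocal L v))
          ((ψ v).symm γ) γ) ∧
      ∀ v ∉ S₀, ∀ g, ψ v g ∈ cmLocalIntegralLevel L 3 (Matrix.of fun i j : Fin 3 => if i.val + j.val + 1 = 3 then (1 : L) else 0) v ↔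
        g ∈ cmLocalIntegralLevel L 3 H v := by
  obtain ⟨ψ, S₀, hconj, hlev⟩ := exists_psi_conj_forall_levelMatching L H hanis hherm
  refine ⟨ψ, S₀, fun v γ' => ?_, fun v γ => ?_, hlev⟩
  · obtain ⟨S, hS⟩ := hconj v
    exact corresponds_of_coe_eq_conj (IsCMField.complexConj L) v (ψ v) S hS γ'
  · obtain ⟨S, hS⟩ := hconj v
    exact corresponds_symm_of_coe_eq_conj (IsCMField.complexConj L) v (ψ v) S hS γ

end CM

end UnitaryGroup

end Literature.NumberTheory.Automorphic

end
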